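import Summits.QuantumFields.YangMills.Theorems.ParabolicTrajectoryLatticeGapOnTrajectorySparseDefectDefs
import Summits.QuantumFields.YangMills.Theorems.ParabolicTrajectoryLatticeGapOnTrajectoryStubSmoothingToGap
import HarnessLib

/-!
# Route `ParabolicTrajectory`, crux `LatticeGapOnTrajectory` (stmt-QuantumFields-10523), line
# `sparse-defect-orbit-window` (SketchIdeator5-r2): stub `stub_gapOfDecay`

Fork of the landed `stub_smoothingToGap` (p95642): the ENGINE (`KREngine`) and the window package
(`OrbitKRWindowsAlong`) are replaced by the engine-independent decay interface `CellDecayAlongP`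
(`…SparseDefectDefs`; `CellDecay` is verbatim the engine's output inequality for one `(cell, w, ν)`).
* §D' `abs_corr_le_far_of_decay`: tower identity (`SpecificationTower`) + `CellDecay` on the two window
  averages; their shell dependence is read off the SHELL-SUPPORTED cell-Lipschitz bound of the
  rough-centre clause (a cell with `δ = 0` cannot move the average, `dependsOn_of_cellwise`) instead
  of the finite-range clause of the window package.
* §E' `abs_latticeConnectedCorr_le_of_decay`: one torus, one time separation (verbatim fork).
* §F' `stub_gapOfDecay`: the eventualities in `k` and the `k`-uniform constant (verbatim fork).
-/

set_option autoImplicit false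

noncomputable section

namespace Summit.QuantumFields.YangMills.Cruxes.LatticeGapOnTrajectory.SparseDefectOrbitWindow

open scoped BigOperators Topology ENNReal ProbabilityTheory
open Filter MeasureTheory
open Literature.Probability.LatticeModels (Specification IsSpecification IsGibbsMeasure glueWith)
open Literature.MathematicalPhysics.QuantumFieldTheory
open Literature.MathematicalPhysics.QuantumLattice
open Summit.QuantumFields.YangMills.Theses.ParabolicTrajectory
open Summit.QuantumFields.YangMills.Cruxes.LatticeGapOnTrajectory.OrbitKantorovichFiniteSize
open Summit.QuantumFields.YangMills.Theorems.LatticeGapOnTrajectory.Negative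

/-- **Far case, abstractly, from cell decay.** For a specification `γ` read on cells, a Gibbs measure
`ν` with `CellDecay cell w ν κ C₀`, and bounded measurable `f`, `g` with `g` supported in the cell `c_B`,
`cdist c_A c_B ≥ 2n₀ + 3`, whose window averages `γ_{W_A} f`, `γ_{W_B} g` are cell-Lipschitz with
SHELL-SUPPORTED bounds of totals `≤ K_A`, `≤ K_B`: the TOWER identity
`∫ f g dν − ∫ f dν ∫ g dν = cov(γ_{W_A} f, γ_{W_B} g)` (`SpecificationTower`; `γ_{W_A} f` is a function of
the shell of `W_A` since a cell with zero Lipschitz bound cannot move it, `dependsOn_of_cellwise`), then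
the decay inequality: the connected correlation is `≤ C₀ K_A K_B e^{-κ (cdist c_A c_B − 2n₀ − 2)}`. -/
theorem abs_corr_le_far_of_decay {μ : Fin 4 → ℕ} {V S : Type} [Fintype V] [MeasurableSpace S]
    (hT : SpecificationTower) {n₀ : ℕ} {κ C₀ : ℝ} (hC₀ : 0 ≤ C₀)
    (cell : V → CoarseIdx μ) (w : CoarseIdx μ → (V → S) → (V → S) → ℝ) (γ : Specification V S)
    (hγ : IsSpecification γ) (ν : Measure (V → S)) (hν : IsGibbsMeasure γ ν)
    (hdec : CellDecay cell w ν κ C₀)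
    {f g : (V → S) → ℝ} {CA CB : ℝ} (hfm : Measurable f) (hgm : Measurable g)
    (hfb : ∀ σ, |f σ| ≤ CA) (hgb : ∀ σ, |g σ| ≤ CB)
    {cA cB : CoarseIdx μ} (hgdep : DependsOn g {v | cell v = cB}) (hfar : 2 * n₀ + 3 ≤ cdist cA cB)
    {δA δB : CoarseIdx μ → ℝ} {KA KB : ℝ}
    (hLipA : IsCellLipBound cell w (windowAvg γ (windowVol cell n₀ cA) f) δA)
    (hLipB : IsCellLipBound cell w (windowAvg γ (windowVol cell n₀ cB) g) δB)
    (hδA : ∀ y, cdist cA y ≠ n₀ + 1 → δA y = 0) (hδB : ∀ y, cdist cB y ≠ n₀ + 1 → δB y = 0)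
    (hSA : ∑ y ∈ Finset.univ.filter (fun y => cdist cA y = n₀ + 1), δA y ≤ KA)
    (hSB : ∑ y ∈ Finset.univ.filter (fun y => cdist cB y = n₀ + 1), δB y ≤ KB) :
    |(∫ σ, f σ * g σ ∂ν) - (∫ σ, f σ ∂ν) * ∫ σ, g σ ∂ν| ≤
      C₀ * KA * KB * Real.exp (-(κ * (cdist cA cB - (2 * n₀ + 2) : ℕ))) := by
  classical
  haveI : IsProbabilityMeasure ν := hν.1
  -- windows and shells
  set WA : Finset V := windowVol cell n₀ cA with hWA
  set WB : Finset V := windowVol cell n₀ cB with hWB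
  set shellA : Finset (CoarseIdx μ) := Finset.univ.filter (fun y => cdist cA y = n₀ + 1) with hshellA
  set shellB : Finset (CoarseIdx μ) := Finset.univ.filter (fun y => cdist cB y = n₀ + 1) with hshellB
  have memWA : ∀ v, v ∈ WA ↔ cdist cA (cell v) ≤ n₀ := fun v => by simp [hWA, windowVol]
  have memWB : ∀ v, v ∈ WB ↔ cdist cB (cell v) ≤ n₀ := fun v => by simp [hWB, windowVol]
  have memShellA : ∀ y, y ∈ shellA ↔ cdist cA y = n₀ + 1 := fun y => by simp [hshellA]
  have memShellB : ∀ y, y ∈ shellB ↔ cdist cB y = n₀ + 1 := fun y => by simp [hshellB]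
  -- the window-averaging toolkit
  obtain ⟨hfhm, hfhb, -, hpullA, hdlrA⟩ := hT V S γ hγ WA f CA hfm hfb
  obtain ⟨hghm, hghb, -, hpullB, hdlrB⟩ := hT V S γ hγ WB g CB hgm hgb
  set fh : (V → S) → ℝ := windowAvg γ WA f with hfh
  set gh : (V → S) → ℝ := windowAvg γ WB g with hgh
  -- (b) the window averages are functions of the shells: a cell with zero Lipschitz bound is invisible
  have shell_dep : ∀ (c : CoarseIdx μ) (φ : (V → S) → ℝ) (δ : CoarseIdx μ → ℝ),
      IsCellLipBound cell w φ δ → (∀ y, cdist c y ≠ n₀ + 1 → δ y = 0) →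
      DependsOn φ {v | cell v ∈ Finset.univ.filter (fun y => cdist c y = n₀ + 1)} := by
    intro c φ δ hLip hδ
    have hdep := dependsOn_of_cellwise cell φ (Finset.univ.filter fun y => cdist c y ≠ n₀ + 1)
      (fun y hy σ τ h => by
        have hy' : cdist c y ≠ n₀ + 1 := by simpa using hy
        have h1 := hLip.le y σ τ h
        rw [hδ y hy', zero_mul, abs_nonpos_iff, sub_eq_zero] at h1
        exact h1)
    exact hdep.mono fun v hv => by
      have hv' : cdist c (cell v) = n₀ + 1 := by simpa using hv
      simpa using hv'
  have hfhshell : DependsOn fh {v | cell v ∈ shellA} := shell_dep cA fh δA hLipA hδA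
  have hghshell : DependsOn gh {v | cell v ∈ shellB} := shell_dep cB gh δB hLipB hδB
  -- (c) the tower identity
  have hg_offA : DependsOn g ((↑WA : Set V)ᶜ) := hgdep.mono fun v hv => by
    have hv' : cell v = cB := hv
    show v ∉ (↑WA : Set V)
    rw [Finset.mem_coe, memWA, hv']
    omega
  have hfh_offB : DependsOn fh ((↑WB : Set V)ᶜ) := hfhshell.mono fun v hv => by
    have hv' : cdist cA (cell v) = n₀ + 1 := (memShellA _).1 hv
    show v ∉ (↑WB : Set V)
    rw [Finset.mem_coe, memWB]
    intro hle
    have h3 := cdist_triangle cA (cell v) cB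
    rw [cdist_comm (cell v) cB] at h3
    omega
  have hgf_b : ∀ σ, |g σ * f σ| ≤ CB * CA := fun σ => by
    rw [abs_mul]
    exact mul_le_mul (hgb σ) (hfb σ) (abs_nonneg _) ((abs_nonneg _).trans (hgb σ))
  have hfhg_b : ∀ σ, |fh σ * g σ| ≤ CA * CB := fun σ => by
    rw [abs_mul]
    exact mul_le_mul (hfhb σ) (hgb σ) (abs_nonneg _) ((abs_nonneg _).trans (hfhb σ))
  have step1 : ∫ σ, f σ * g σ ∂ν = ∫ σ, g σ * fh σ ∂ν := by
    have hdlr := (hT V S γ hγ WA (fun σ => g σ * f σ) (CB * CA) (hgm.mul hfm) hgf_b).2.2.2.2 ν hν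
    have hp : ∀ η, windowAvg γ WA (fun σ => g σ * f σ) η = g η * fh η :=
      hpullA g hgm ⟨CB, hgb⟩ hg_offA
    simp_rw [hp] at hdlr
    rw [hdlr]
    exact integral_congr_ae (Eventually.of_forall fun σ => mul_comm _ _)
  have step2 : ∫ σ, g σ * fh σ ∂ν = ∫ σ, fh σ * gh σ ∂ν := by
    have hdlr := (hT V S γ hγ WB (fun σ => fh σ * g σ) (CA * CB) (hfhm.mul hgm) hfhg_b).2.2.2.2 ν hν
    have hp : ∀ η, windowAvg γ WB (fun σ => fh σ * g σ) η = fh η * gh η :=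
      hpullB fh hfhm ⟨CA, hfhb⟩ hfh_offB
    simp_rw [hp] at hdlr
    rw [hdlr]
    exact integral_congr_ae (Eventually.of_forall fun σ => mul_comm _ _)
  have step3 : ∫ σ, f σ ∂ν = ∫ σ, fh σ ∂ν := (hdlrA ν hν).symm
  have step4 : ∫ σ, g σ ∂ν = ∫ σ, gh σ ∂ν := (hdlrB ν hν).symm
  have hfh2 : MemLp fh 2 ν := MemLp.of_bound hfhm.aestronglyMeasurable CA
    (Eventually.of_forall fun σ => by rw [Real.norm_eq_abs]; exact hfhb σ)
  have hgh2 : MemLp gh 2 ν := MemLp.of_bound hghm.aestronglyMeasurable CB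
    (Eventually.of_forall fun σ => by rw [Real.norm_eq_abs]; exact hghb σ)
  have hcov : cov[fh, gh; ν] = (∫ σ, fh σ * gh σ ∂ν) - (∫ σ, fh σ ∂ν) * ∫ σ, gh σ ∂ν :=
    ProbabilityTheory.covariance_eq_sub hfh2 hgh2
  have htower : (∫ σ, f σ * g σ ∂ν) - (∫ σ, f σ ∂ν) * ∫ σ, g σ ∂ν = cov[fh, gh; ν] := by
    rw [hcov, step1, step2, step3, step4]
  -- (e) the decay interface
  have hD : ∀ x ∈ shellA, ∀ y ∈ shellB, cdist cA cB - (2 * n₀ + 2) ≤ cdist x y := by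
    intro x hx y hy
    have hx' := (memShellA x).1 hx
    have hy' := (memShellB y).1 hy
    have h1 := cdist_triangle cA x y
    have h2 := cdist_triangle cA y cB
    rw [cdist_comm y cB] at h2
    omega
  have hcovb := hdec fh gh shellA shellB δA δB (cdist cA cB - (2 * n₀ + 2)) hfhm hghm ⟨CA, hfhb⟩
    ⟨CB, hghb⟩ hfhshell hghshell hLipA hLipB hD
  have hSA0 : 0 ≤ ∑ y ∈ shellA, δA y := Finset.sum_nonneg fun y _ => hLipA.nonneg y
  have hSB0 : 0 ≤ ∑ y ∈ shellB, δB y := Finset.sum_nonneg fun y _ => hLipB.nonneg y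
  rw [htower]
  refine hcovb.trans (mul_le_mul_of_nonneg_right ?_ (Real.exp_pos _).le)
  exact mul_le_mul (mul_le_mul_of_nonneg_left hSA hC₀) hSB hSB0 (mul_nonneg hC₀ (hSA0.trans hSA))

/-- **On one torus, from cell decay** (verbatim fork of `abs_latticeConnectedCorr_le`). Torus side `N`,
cell scale `b ≥ 4w + 4` with `(2n₀+3)·2b ≤ N`, time separation `m < N/2`, species `A`, `B` with `≤ s`
edges based in `[-w, w]⁴`, the DLR description of Wilson's torus measure at `β`, and for EVERY family of
axis frames of scale `b` with `≥ 2n₀ + 3` cells per axis: cell decay in the orbit weight + rough-centre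
bound. Frames adapted to the two supports (`TorusFramesExist.2`), `m ≤ 2b (cdist c_A c_B + 1)`
(`TorusFramesExist.1`), near case trivial, far case `abs_corr_le_far_of_decay`:
`|⟨A ; τ_m B⟩| ≤ (2‖A‖‖B‖ + C₀ |K_s‖A‖| |K_s‖B‖|) e^{κ(2n₀+3)/2} e^{-x}` for every `x ≤ κ m / (4 b)`. -/
theorem abs_latticeConnectedCorr_le_of_decay {G : Type} [Group G] [TopologicalSpace G]
    [IsTopologicalGroup G] [CompactSpace G] [MeasurableSpace G] [BorelSpace G]
    (hTF : TorusFramesExist) (hT : SpecificationTower) {n₀ : ℕ} {κ C₀ : ℝ} (hκ : 0 ≤ κ) (hC₀ : 0 ≤ C₀)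
    (r : LatticeRep G) (β α Ks : ℝ) (s N b w m : ℕ) [NeZero N]
    (A B : YMSpecies G) {CA CB : ℝ} (hCA : ∀ U, |A.F U| ≤ CA) (hCB : ∀ U, |B.F U| ≤ CB)
    (hsA : A.supp.card ≤ s) (hsB : B.supp.card ≤ s)
    (hwA : ∀ e ∈ A.supp, ∀ i, |e.1 i| ≤ (w : ℤ)) (hwB : ∀ e ∈ B.supp, ∀ i, |e.1 i| ≤ (w : ℤ))
    (hb1 : 1 ≤ b) (hb4 : 4 * w + 4 ≤ b) (hbN : (2 * n₀ + 3) * (2 * b) ≤ N) (hmN : 2 * m < N)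
    (hγ : IsSpecification (torusYM r.ρ β N))
    (hGibbs : IsGibbsMeasure (torusYM r.ρ β N) (wilsonMeasure (d := 4) (L := N) r.ρ β))
    (hdec : ∀ (μ : Fin 4 → ℕ) (q : (i : Fin 4) → ZMod N → ZMod (μ i + 1)),
        (∀ i, 2 * n₀ + 3 ≤ μ i + 1) → (∀ i, IsTorusFrame N b (q i)) →
          CellDecay (cellOf q) (orbitWeight r α q) (wilsonMeasure (d := 4) (L := N) r.ρ β) κ C₀ ∧
          RoughCentreBound r β N q α n₀ s Ks)
    {x : ℝ} (hx : x ≤ κ * m / (4 * b)) :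
    |latticeConnectedCorr r.ρ β N A.F B.F m| ≤
      (2 * (CA * CB) + C₀ * |Ks * CA| * |Ks * CB|) * Real.exp (κ * (2 * n₀ + 3) / 2) *
        Real.exp (-x) := by
  classical
  haveI : IsProbabilityMeasure (wilsonMeasure (d := 4) (L := N) r.ρ β) := hGibbs.1
  have hCA0 : 0 ≤ CA := (abs_nonneg _).trans (hCA 1)
  have hCB0 : 0 ≤ CB := (abs_nonneg _).trans (hCB 1)
  -- the second prescribed centre on each axis: the time shift `m e₀` read mod `N`
  set x₂ : Fin 4 → ZMod N :=
    Literature.Probability.LatticeModels.Torus.proj N (Pi.single 0 (m : ℤ)) with hx₂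
  -- frames, axis by axis
  have hfr : ∀ i : Fin 4, ∃ (μi : ℕ) (qi : ZMod N → ZMod (μi + 1)), 2 * n₀ + 3 ≤ μi + 1 ∧
      IsTorusFrame N b qi ∧ (∀ j : ℕ, j ≤ 2 * w → qi (0 - (w : ZMod N) + (j : ZMod N)) = qi 0) ∧
      (∀ j : ℕ, j ≤ 2 * w → qi (x₂ i - (w : ZMod N) + (j : ZMod N)) = qi (x₂ i)) :=
    fun i => hTF.2 n₀ N b w 0 (x₂ i) inferInstance hb1 hb4 hbN
  choose μ q hμ hframe harcA harcB using hfr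
  obtain ⟨hdecq, hRC⟩ := hdec μ q hμ hframe
  -- the time translation vector `-m e₀` and the two observables on the torus
  set v : Literature.Probability.LatticeModels.Site 4 := -Pi.single 0 (m : ℤ) with hv
  set f : GaugeConfig 4 N G → ℝ := fun U => A.F (torusLift N U) with hf
  set g : GaugeConfig 4 N G → ℝ := fun U => B.F (configShift v (torusLift N U)) with hg
  have hfm : Measurable f := A.measurable.comp (measurable_torusLift N)
  have hgm : Measurable g :=
    B.measurable.comp ((configShift _).measurable.comp (measurable_torusLift N))
  have hfb : ∀ U, |f U| ≤ CA := fun U => hCA _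
  have hgb : ∀ U, |g U| ≤ CB := fun U => hCB _
  have hcorr : latticeConnectedCorr r.ρ β N A.F B.F m =
      (∫ U, f U * g U ∂(wilsonMeasure (d := 4) (L := N) r.ρ β)) -
        (∫ U, f U ∂(wilsonMeasure (d := 4) (L := N) r.ρ β)) *
          ∫ U, g U ∂(wilsonMeasure (d := 4) (L := N) r.ρ β) := by
    unfold latticeConnectedCorr
    rw [← integral_comp_configShift_torusLift r.ρ β N B.F v]
  -- cells of the two supports
  set cA : CoarseIdx μ := fun i => q i 0 with hcA
  set cB : CoarseIdx μ := fun i => q i (x₂ i) with hcB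
  have harc : ∀ z : ℤ, |z| ≤ w → ∃ j : ℕ, j ≤ 2 * w ∧
      ((z : ℤ) : ZMod N) = 0 - (w : ZMod N) + (j : ZMod N) := by
    intro z hz
    obtain ⟨hlo, hhi⟩ := abs_le.1 hz
    obtain ⟨j, hj⟩ : ∃ j : ℕ, (j : ℤ) = z + w := ⟨(z + w).toNat, Int.toNat_of_nonneg (by omega)⟩
    refine ⟨j, by omega, ?_⟩
    calc ((z : ℤ) : ZMod N) = (((z + w : ℤ)) : ZMod N) - (w : ZMod N) := by push_cast; ring
      _ = (j : ZMod N) - (w : ZMod N) := by rw [← hj, Int.cast_natCast]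
      _ = 0 - (w : ZMod N) + (j : ZMod N) := by ring
  have hcellA : ∀ e ∈ A.supp, cellOf q (torusEdge N e) = cA := by
    intro e he
    funext i
    obtain ⟨j, hj, hje⟩ := harc (e.1 i) (hwA e he i)
    show q i (((e.1 i : ℤ) : ZMod N)) = q i 0
    rw [hje, harcA i j hj]
  have hcellB : ∀ e ∈ B.supp, cellOf q (torusEdge N (e.1 - v, e.2)) = cB := by
    intro e he
    funext i
    obtain ⟨j, hj, hje⟩ := harc (e.1 i) (hwB e he i)
    show q i ((((e.1 - v) i : ℤ) : ZMod N)) = q i (x₂ i)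
    have : ((((e.1 - v) i : ℤ) : ZMod N)) = x₂ i - (w : ZMod N) + (j : ZMod N) := by
      simp only [hv, Pi.sub_apply, Pi.neg_apply, sub_neg_eq_add, Int.cast_add, hje, hx₂,
        Literature.Probability.LatticeModels.Torus.proj_apply]
      ring
    rw [this, harcB i j hj]
  set EA : Finset (Edge 4 N) := A.supp.image (torusEdge N) with hEA
  set EB : Finset (Edge 4 N) :=
    (B.supp.image fun e : Literature.MathematicalPhysics.QuantumLattice.ZdEdge 4 =>
      (e.1 - v, e.2)).image (torusEdge N) with hEB
  have hfdepE : DependsOn f (↑EA : Set (Edge 4 N)) := dependsOn_comp_torusLift A.isCylinder N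
  have hgdepE : DependsOn g (↑EB : Set (Edge 4 N)) :=
    dependsOn_comp_torusLift (IsCylinder.comp_configShift B.isCylinder v) N
  have hcardA : EA.card ≤ s := Finset.card_image_le.trans hsA
  have hcardB : EB.card ≤ s := Finset.card_image_le.trans (Finset.card_image_le.trans hsB)
  have hcellA' : ∀ e ∈ EA, cellOf q e = cA := by
    intro e he
    obtain ⟨e₀, he₀, rfl⟩ := Finset.mem_image.1 he
    exact hcellA e₀ he₀
  have hcellB' : ∀ e ∈ EB, cellOf q e = cB := by
    intro e he
    obtain ⟨e₁, he₁, rfl⟩ := Finset.mem_image.1 he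
    obtain ⟨e₀, he₀, rfl⟩ := Finset.mem_image.1 he₁
    exact hcellB e₀ he₀
  have hgdep : DependsOn g {v | cellOf q v = cB} := hgdepE.mono fun v hv => hcellB' v hv
  -- the time axis: `m ≤ 2b (cdist c_A c_B + 1)`
  have hx₂0 : x₂ 0 = (m : ZMod N) := by
    simp [hx₂, Literature.Probability.LatticeModels.Torus.proj_apply]
  have htime := hTF.1 N b (μ 0) (q 0) inferInstance hb1 (hframe 0) 0 (x₂ 0)
  have hmh : m ≤ N / 2 := by omega
  have hmval : ((x₂ 0 - 0).valMinAbs).natAbs = m := by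
    rw [sub_zero, hx₂0, ZMod.valMinAbs_natCast_of_le_half hmh, Int.natAbs_natCast]
  have hℓ : ((q 0 (x₂ 0) - q 0 0).valMinAbs).natAbs ≤ cdist cA cB := by
    rw [cdist_comm]
    exact natAbs_valMinAbs_sub_le_cdist cB cA 0
  have hmb : m ≤ 2 * b * (cdist cA cB + 1) :=
    calc m = ((x₂ 0 - 0).valMinAbs).natAbs := hmval.symm
      _ ≤ 2 * b * (((q 0 (x₂ 0) - q 0 0).valMinAbs).natAbs + 1) := htime
      _ ≤ 2 * b * (cdist cA cB + 1) := Nat.mul_le_mul_left _ (Nat.succ_le_succ hℓ)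
  have hb0 : (0 : ℝ) < b := by exact_mod_cast hb1
  have hmbR : (m : ℝ) ≤ 2 * b * (cdist cA cB + 1) := by exact_mod_cast hmb
  have hxle : x ≤ κ * ((cdist cA cB : ℝ) + 1) / 2 := by
    refine hx.trans ?_
    rw [div_le_div_iff₀ (by positivity) two_pos]
    have := mul_le_mul_of_nonneg_left hmbR hκ
    nlinarith [this]
  have hP0 : 0 ≤ 2 * (CA * CB) + C₀ * |Ks * CA| * |Ks * CB| := by positivity
  rw [hcorr]
  rcases le_or_gt (cdist cA cB) (2 * n₀ + 2) with hnear | hfar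
  · -- NEAR case: the trivial bound
    have h1 := abs_corr_le_two_mul (wilsonMeasure (d := 4) (L := N) r.ρ β) hfb hgb
    have hxE : x ≤ κ * (2 * n₀ + 3) / 2 := by
      refine hxle.trans ?_
      have h2 : (cdist cA cB : ℝ) + 1 ≤ 2 * n₀ + 3 := by
        exact_mod_cast (by omega : cdist cA cB + 1 ≤ 2 * n₀ + 3)
      have h3 := mul_le_mul_of_nonneg_left h2 hκ
      linarith
    have hone : 1 ≤ Real.exp (κ * (2 * n₀ + 3) / 2) * Real.exp (-x) := by
      rw [← Real.exp_add]
      exact Real.one_le_exp (by linarith)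
    calc _ ≤ 2 * (CA * CB) := h1
      _ ≤ (2 * (CA * CB) + C₀ * |Ks * CA| * |Ks * CB|) * 1 := by
          rw [mul_one]
          exact le_add_of_nonneg_right (by positivity)
      _ ≤ (2 * (CA * CB) + C₀ * |Ks * CA| * |Ks * CB|) *
            (Real.exp (κ * (2 * n₀ + 3) / 2) * Real.exp (-x)) := mul_le_mul_of_nonneg_left hone hP0
      _ = _ := by ring
  · -- FAR case: the tower identity and the decay interface
    obtain ⟨δA, hLipA, hδA0, hSA⟩ := hRC cA f EA CA hcardA hcellA' hfdepE hfm hfb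
    obtain ⟨δB, hLipB, hδB0, hSB⟩ := hRC cB g EB CB hcardB hcellB' hgdepE hgm hgb
    have h1 := abs_corr_le_far_of_decay hT hC₀ (cellOf q) (orbitWeight r α q) (torusYM r.ρ β N) hγ _
      hGibbs hdecq hfm hgm hfb hgb hgdep (by omega) hLipA hLipB hδA0 hδB0 hSA hSB
    have hKB0 : 0 ≤ Ks * CB := (Finset.sum_nonneg fun y _ => hLipB.nonneg y).trans hSB
    have hD : ((cdist cA cB - (2 * n₀ + 2) : ℕ) : ℝ) = cdist cA cB - (2 * n₀ + 2) := by
      rw [Nat.cast_sub (by omega)]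
      push_cast
      ring
    have hexp : Real.exp (-(κ * ((cdist cA cB - (2 * n₀ + 2) : ℕ) : ℝ))) ≤
        Real.exp (κ * (2 * n₀ + 3) / 2) * Real.exp (-x) := by
      rw [← Real.exp_add, Real.exp_le_exp, hD]
      have hdpos : (0 : ℝ) ≤ (cdist cA cB : ℝ) - (2 * n₀ + 2) := by
        have : ((2 * n₀ + 3 : ℕ) : ℝ) ≤ cdist cA cB := by exact_mod_cast hfar
        push_cast at this
        linarith
      nlinarith [mul_nonneg hκ hdpos]
    calc _ ≤ C₀ * (Ks * CA) * (Ks * CB) *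
            Real.exp (-(κ * ((cdist cA cB - (2 * n₀ + 2) : ℕ) : ℝ))) := h1
      _ ≤ C₀ * |Ks * CA| * |Ks * CB| *
            Real.exp (-(κ * ((cdist cA cB - (2 * n₀ + 2) : ℕ) : ℝ))) := by
          apply mul_le_mul_of_nonneg_right _ (Real.exp_pos _).le
          exact mul_le_mul (mul_le_mul_of_nonneg_left (le_abs_self _) hC₀) (le_abs_self _) hKB0
            (mul_nonneg hC₀ (abs_nonneg _))
      _ ≤ C₀ * |Ks * CA| * |Ks * CB| * (Real.exp (κ * (2 * n₀ + 3) / 2) * Real.exp (-x)) :=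
          mul_le_mul_of_nonneg_left hexp (by positivity)
      _ ≤ (2 * (CA * CB) + C₀ * |Ks * CA| * |Ks * CB|) *
            (Real.exp (κ * (2 * n₀ + 3) / 2) * Real.exp (-x)) := by
          apply mul_le_mul_of_nonneg_right _ (by positivity)
          nlinarith [mul_nonneg hCA0 hCB0]
      _ = _ := by ring

/-- **stub_gapOfDecay** — DEPLOYMENT ON THE SYMMETRIC TORUS from the decay interface (`G`-blind; fork
of the landed `stub_smoothingToGap`, p95642). The frames, the window-averaging toolkit, the DLR
description of Wilson's torus measure and `CellDecayAlongP` (scale `t`, radius `n₀`, rate `κ`, constant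
`C₀`, resolution `α`, rough-centre constants `K_s`) give the crux's lattice half with `Δ = κ/(4t)`:
for species `A, B` (supports of `≤ s` edges in `[-w, w]⁴`), eventually in `k` the package holds at `s`,
`b_k = t·M^{n_k} ≥ 4w + 4` (`tendsto_natPow_of_shape`) and `(2n₀+3)·2b_k ≤ L_k ≤ 2S+1` (`a_k L_k → ∞`);
then `abs_latticeConnectedCorr_le_of_decay` with `x = Δ a_k m = κ m/(4 b_k)` gives the clause of
`HasLatticeMassGap` with the `k`-uniform constant `(2‖A‖‖B‖ + C₀ |K_s‖A‖| |K_s‖B‖|) e^{κ(2n₀+3)/2}`. -/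
theorem stub_gapOfDecay :
    ∀ (G : Type) [Group G] [TopologicalSpace G] [IsTopologicalGroup G] [CompactSpace G]
      [MeasurableSpace G] [BorelSpace G] (r : LatticeRep G) (M : ℕ) (sch : SpeciesScheme (YMSpecies G))
      (n : ℕ → ℕ), 2 ≤ M → (∀ k, sch.a k = ((M : ℝ) ^ n k)⁻¹) →
      TorusFramesExist → SpecificationTower → WilsonTorusDLR r → CellDecayAlongP r M sch n →
        ∃ Δ : ℝ, 0 < Δ ∧ HasLatticeMassGap r sch Δ := by
  intro G _ _ _ _ _ _ r M sch n hM hshape hTF hT hDLR hD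
  obtain ⟨t, n₀, κ, C₀, α, K, ht, hκ, hC₀, -, -, hDs⟩ := hD
  have ht0 : (0 : ℝ) < t := by exact_mod_cast ht
  refine ⟨κ / (4 * t), div_pos hκ (by positivity), fun A B => ?_⟩
  obtain ⟨CA, hCA⟩ := A.bounded
  obtain ⟨CB, hCB⟩ := B.bounded
  -- support radius `w` and support size `s` of the two species
  set w : ℕ := (A.supp ∪ B.supp).sup fun e => Finset.univ.sup fun i : Fin 4 => (e.1 i).natAbs with hw
  have hwAB : ∀ e ∈ A.supp ∪ B.supp, ∀ i, |e.1 i| ≤ (w : ℤ) := by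
    intro e he i
    have h1 : (e.1 i).natAbs ≤ Finset.univ.sup (fun j : Fin 4 => (e.1 j).natAbs) :=
      Finset.le_sup (f := fun j : Fin 4 => (e.1 j).natAbs) (Finset.mem_univ i)
    have h2 : Finset.univ.sup (fun j : Fin 4 => (e.1 j).natAbs) ≤ w :=
      Finset.le_sup (f := fun e : Literature.MathematicalPhysics.QuantumLattice.ZdEdge 4 =>
        Finset.univ.sup fun j : Fin 4 => (e.1 j).natAbs) he
    rw [Int.abs_eq_natAbs]
    exact_mod_cast h1.trans h2
  have hwA : ∀ e ∈ A.supp, ∀ i, |e.1 i| ≤ (w : ℤ) := fun e he => hwAB e (Finset.mem_union_left _ he)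
  have hwB : ∀ e ∈ B.supp, ∀ i, |e.1 i| ≤ (w : ℤ) := fun e he => hwAB e (Finset.mem_union_right _ he)
  set s : ℕ := max A.supp.card B.supp.card with hs
  refine ⟨(2 * (CA * CB) + C₀ * |K s * CA| * |K s * CB|) * Real.exp (κ * (2 * n₀ + 3) / 2), ?_⟩
  have E2 : ∀ᶠ k in atTop, ((4 * w + 4 : ℕ) : ℝ) ≤ (M : ℝ) ^ n k :=
    (tendsto_natPow_of_shape sch hshape).eventually_ge_atTop _
  have E3 : ∀ᶠ k in atTop, ((2 * (2 * n₀ + 3) * t : ℕ) : ℝ) ≤ sch.a k * sch.L k :=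
    sch.tendsto_L.eventually_ge_atTop _
  filter_upwards [hDs s, E2, E3] with k hk1 hk2 hk3 S hS m hm
  have hb4 : 4 * w + 4 ≤ t * M ^ n k := by
    have h1 : 4 * w + 4 ≤ M ^ n k := by exact_mod_cast hk2
    exact h1.trans (Nat.le_mul_of_pos_left _ (by omega))
  have hb1 : 1 ≤ t * M ^ n k := le_trans (by omega) hb4
  have hL : M ^ n k * (2 * (2 * n₀ + 3) * t) ≤ sch.L k := by
    rw [hshape k] at hk3
    have hc : (0 : ℝ) < (M : ℝ) ^ n k := by positivity
    have := (le_inv_mul_iff₀ hc).1 hk3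
    exact_mod_cast this
  have hbN : (2 * n₀ + 3) * (2 * (t * M ^ n k)) ≤ 2 * S + 1 :=
    calc (2 * n₀ + 3) * (2 * (t * M ^ n k)) = M ^ n k * (2 * (2 * n₀ + 3) * t) := by ring
      _ ≤ sch.L k := hL
      _ ≤ S := hS
      _ ≤ 2 * S + 1 := by omega
  have hmN : 2 * m < 2 * S + 1 := by omega
  obtain ⟨hγ, hGibbs⟩ := hDLR (sch.β k) (2 * S + 1)
  have hx : κ / (4 * t) * (sch.a k * m) ≤ κ * m / (4 * ((t * M ^ n k : ℕ) : ℝ)) := by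
    rw [hshape k]
    have hc : (0 : ℝ) < (M : ℝ) ^ n k := by positivity
    apply le_of_eq
    push_cast
    field_simp
  exact abs_latticeConnectedCorr_le_of_decay hTF hT hκ.le hC₀ r (sch.β k) (α k) (K s) s (2 * S + 1)
    (t * M ^ n k) w m A B hCA hCB (le_max_left _ _) (le_max_right _ _) hwA hwB hb1 hb4 hbN hmN hγ
    hGibbs (hk1 S hS) hx

end Summit.QuantumFields.YangMills.Cruxes.LatticeGapOnTrajectory.SparseDefectOrbitWindow

end
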